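import Summits.Ventures.PercRepro0.Potential
import Summits.Ventures.PercRepro0.T2Twin

/-!
# P6(a) «at most one», and `P_½(LR_n) = ½` exactly (seat p1, gen 1)

Lean twin, on the cell's `Defs.lean`, of P9-separation-p1-v1 Lemma 3.1 («a rectangle is not crossed both
ways») and of P6-dualcrossing-p1-v1 Theorem 3.2 / Theorem 4.4, OFF the declaration path (lead 23:00:52Z), in
the coordinates of the identification `ψ` (`dualConfig` of `DualMap.lean`):

* `not_both : ω ∈ LR_n → dualConfig ω ∉ LR_n` — proof by the column-count potential of `Potential.lean`
  along the dual crossing (rather than P9's closed walk through the outside of the box): with `C` the edge set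
  of a left–right PATH `γ` of `ω` (Mathlib's `bypass`), the potential `pot C` satisfies (★) across every step of
  a dual crossing `δ` of `B_n` (its vertical steps lie in the columns `1, …, n`, where every vertex has even
  degree in `C` — the odd-degree vertices of a trail are its two ends, `IsTrail.even_countP_edges_iff`), `δ`
  crosses no bond of `C` (its bonds are closed, `C` is open), `pot C` vanishes at the start of `δ` (height `0`)
  and is ODD at its end (column `t₁ ≤ n`, height `n+1`: the half-plane count `bdryCount_halfPlane`, whose only
  odd-degree vertex is the start of `γ`) — contradicting the telescoped parity;
* `exactly_one`: P6 Theorem 3.2 through `ψ` — exactly one of `ω ∈ LR_n`, `dualConfig ω ∈ LR_n`;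
* `P_half_LR_eq_half`: P6 Theorem 4.4 — `P_½(LR_n) = ½` for every `n` (with `half_le_P_LR` of `T2Twin.lean`).

Imports only landed PercRepro0 modules (which import Mathlib). No definitions, no instances, no axioms.
-/

namespace Summit.Ventures.PercRepro0.Separation

open Summit.Ventures.PercRepro0.Defs Summit.Ventures.PercRepro0.Crossing
  Summit.Ventures.PercRepro0.DualMap Summit.Ventures.PercRepro0.EdgeParity
  Summit.Ventures.PercRepro0.Potential Summit.Ventures.PercRepro0.DualCut
  Summit.Ventures.PercRepro0.DualCrossing
open MeasureTheory ProbabilityTheory unitInterval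
open scoped ENNReal Classical

/-! ## The edge set of a trail and its odd-degree vertices -/

/-- The degree of `z` in the edge set of a trail is the number of its edges containing `z`. -/
theorem edeg_toFinset_eq_countP {u v : Vertex 2} (p : (lattice 2).Walk u v) (hp : p.IsTrail) (z : Vertex 2) :
    edeg p.edges.toFinset z = p.edges.countP (fun e => decide (z ∈ e)) := by
  rw [edeg, List.countP_eq_length_filter, ← List.toFinset_card_of_nodup (hp.edges_nodup.filter _),
    List.toFinset_filter]
  congr 1
  refine Finset.filter_congr fun e _ => ?_
  simp

/-- The odd-degree vertices of a trail with distinct ends are exactly its two ends. -/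
theorem odd_edeg_iff {u v : Vertex 2} (p : (lattice 2).Walk u v) (hp : p.IsTrail) (huv : u ≠ v)
    (z : Vertex 2) : Odd (edeg p.edges.toFinset z) ↔ z = u ∨ z = v := by
  rw [edeg_toFinset_eq_countP p hp, ← Nat.not_even_iff_odd, hp.even_countP_edges_iff]
  constructor
  · intro h
    by_contra hcon
    exact h fun _ => ⟨fun h' => hcon (Or.inl h'), fun h' => hcon (Or.inr h')⟩
  · rintro (rfl | rfl) h
    · exact (h huv).1 rfl
    · exact (h huv).2 rfl

/-! ## «At most one» -/

/-- **P9 Lemma 3.1 through `ψ`**: a configuration and its dual configuration never both cross `B_n`. -/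
theorem not_both {n : ℕ} {ω : Config 2} (hω : ω ∈ LR n) : dualConfig ω ∉ LR n := by
  intro hdual
  obtain ⟨a, ha, c, hc, γ0, hγsupp, hγopen⟩ := (mem_LR_iff n ω).1 hω
  obtain ⟨b, hbL, t, htR, δ, hδsupp, hδopen⟩ := (mem_LR_iff n (dualConfig ω)).1 hdual
  -- the primal crossing as a path, and its edge set `C`
  set γ := γ0.bypass with hγ
  have hpath : γ.IsPath := γ0.bypass_isPath
  have hsupp : ∀ z ∈ γ.support, z ∈ rect n := fun z hz =>
    hγsupp z (γ0.support_bypass_subset_support hz)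
  have hopen : ∀ e ∈ γ.edges, e ∈ ω := fun e he => hγopen e (γ0.edges_bypass_subset_edges he)
  set C := γ.edges.toFinset with hC
  have hac : a ≠ c := by
    intro h
    have h1 := ha.1
    have h2 := hc.1
    rw [h] at h1
    omega
  have hCbonds : ∀ e ∈ C, e ∈ bonds 2 := fun e he =>
    γ.edges_subset_edgeSet (List.mem_toFinset.1 he)
  have hCopen : ∀ e ∈ C, e ∈ ω := fun e he => hopen e (List.mem_toFinset.1 he)
  have hCrect : ∀ e ∈ C, ∀ z ∈ e, z ∈ rect n := by
    intro e he z hz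
    induction e using Sym2.ind with
    | h x y =>
      rw [Sym2.mem_iff] at hz
      rcases hz with rfl | rfl
      · exact hsupp z (γ.fst_mem_support_of_mem_edges (List.mem_toFinset.1 he))
      · exact hsupp z (γ.snd_mem_support_of_mem_edges (List.mem_toFinset.1 he))
  have hodd : ∀ z, Odd (edeg C z) ↔ z = a ∨ z = c := odd_edeg_iff γ hpath.isTrail hac
  -- every vertex of a column `1, …, n` has even degree in `C`
  have heven : ∀ z : Vertex 2, 1 ≤ z 0 → z 0 ≤ n → Even (edeg C z) := by
    intro z h1 h2
    rw [← Nat.not_odd_iff_even, hodd]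
    rintro (rfl | rfl)
    · have := ha.1; omega
    · have := hc.1; omega
  -- (★) across every step of the dual crossing
  have hstep : ∀ x y : Vertex 2, s(x, y) ∈ δ.edges →
      Even (pot C x + pot C y + (if dualEdge s(x, y) ∈ C then 1 else 0)) := by
    intro x y hxy
    have hx : x ∈ rect n := hδsupp x (δ.fst_mem_support_of_mem_edges hxy)
    have hy : y ∈ rect n := hδsupp y (δ.snd_mem_support_of_mem_edges hxy)
    have hadj := (mem_bonds_iff x y).1 (δ.edges_subset_edgeSet hxy)
    obtain ⟨hx0, hx1, hx2, hx3⟩ := hx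
    obtain ⟨hy0, hy1, hy2, hy3⟩ := hy
    rcases hadj with ⟨h1, h0⟩ | ⟨h0, h1⟩
    · rcases (abs_eq (zero_le_one' ℤ)).1 h0 with h | h
      · -- y = x − e₀
        have hx' : x = pt (y 0 + 1) (y 1) := eq_pt_of (by omega) (by omega)
        have hy' : y = pt (y 0) (y 1) := eq_pt y
        rw [hx', hy', Sym2.eq_swap, add_comm (pot C _) (pot C _)]
        exact even_step_h C (y 0) (y 1)
      · -- y = x + e₀
        have hx' : x = pt (x 0) (x 1) := eq_pt x
        have hy' : y = pt (x 0 + 1) (x 1) := eq_pt_of (by omega) (by omega)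
        rw [hx', hy']
        exact even_step_h C (x 0) (x 1)
    · rcases (abs_eq (zero_le_one' ℤ)).1 h1 with h | h
      · -- y = x − e₁: the half-column is the column `x 1 = y 1 + 1 ∈ [1, n]`
        have hx' : x = pt (y 0) (y 1 + 1) := eq_pt_of (by omega) (by omega)
        have hy' : y = pt (y 0) (y 1) := eq_pt y
        rw [hx', hy', Sym2.eq_swap, add_comm (pot C _) (pot C _)]
        refine even_step_v C hCbonds (y 0) (y 1) fun z hz0 _ => heven z (by omega) (by omega)
      · -- y = x + e₁: the half-column is the column `y 1 = x 1 + 1 ∈ [1, n]`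
        have hx' : x = pt (x 0) (x 1) := eq_pt x
        have hy' : y = pt (x 0) (x 1 + 1) := eq_pt_of (by omega) (by omega)
        rw [hx', hy']
        refine even_step_v C hCbonds (x 0) (x 1) fun z hz0 _ => heven z (by omega) (by omega)
  have htel := even_pot_add_crossCount C δ hstep
  -- the dual crossing crosses no bond of `C`
  have hcr : crossCount C δ = 0 := by
    rw [crossCount, List.countP_eq_zero]
    intro e he
    rw [decide_eq_true_eq]
    intro heC
    have h1 : e ∈ dualConfig ω := hδopen e he
    rw [mem_dualConfig_iff_of_mem ω (δ.edges_subset_edgeSet he)] at h1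
    exact h1 (hCopen _ heC)
  -- the potential vanishes at the start (height `0`)
  have hb0 : pot C b = 0 := by
    rw [pot, hbL.1]
    refine W_eq_zero C _ 0 fun y hy hmem => ?_
    have := hCrect _ hmem (pt (b 1) y) (by rw [hb, Sym2.mem_iff]; exact Or.inl rfl)
    rw [pt_mem_rect] at this
    omega
  -- the potential is odd at the end (column `t 1 ≤ n`, height `n+1`)
  have ht1 : Odd (pot C t) := by
    rw [pot, htR.1, ← bdryCount_halfPlane C hCbonds (t 1) ((n : ℤ) + 1) (fun y hy => by
      have := hCrect _ hy (pt (t 1) y) (by rw [hb, Sym2.mem_iff]; exact Or.inl rfl)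
      rw [pt_mem_rect] at this
      omega)]
    rw [← Nat.not_even_iff_odd, even_bdryCount_iff C
      (fun e he => SimpleGraph.not_isDiag_of_mem_edgeSet _ (hCbonds e he))]
    have hfilter : (vertsIn C (halfPlane (t 1))).filter (fun z => Odd (edeg C z)) = {a} := by
      ext z
      simp only [Finset.mem_filter, mem_vertsIn, Finset.mem_singleton, hodd, halfPlane, Set.mem_setOf_eq]
      constructor
      · rintro ⟨⟨-, hz⟩, hza | hzc⟩
        · exact hza
        · exfalso
          have := hc.1
          have := htR.2.2
          rw [hzc] at hz
          omega
      · intro hza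
        rw [hza]
        refine ⟨⟨?_, by rw [ha.1]; exact htR.2.1⟩, Or.inl rfl⟩
        have hpos : 0 < edeg C a := Nat.pos_of_ne_zero (by
          intro h0
          have := (hodd a).2 (Or.inl rfl)
          rw [h0] at this
          exact (Nat.not_even_iff_odd.2 this) ⟨0, rfl⟩)
        exact exists_mem_of_edeg_pos C a hpos
    rw [hfilter, Finset.card_singleton]
    decide
  rw [hcr, hb0, zero_add, add_zero] at htel
  exact (Nat.not_even_iff_odd.2 ht1) htel

/-- **P6 Theorem 3.2 through `ψ`**: exactly one of `ω ∈ LR_n`, `dualConfig ω ∈ LR_n`. -/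
theorem exactly_one (n : ℕ) (ω : Config 2) : Xor (ω ∈ LR n) (dualConfig ω ∈ LR n) := by
  rcases LR_or_dual n ω with h | h
  · exact Or.inl ⟨h, not_both h⟩
  · refine Or.inr ⟨h, fun h' => not_both h' h⟩

/-- The dual crossing event is the complement of the crossing event. -/
theorem preimage_dualConfig_LR (n : ℕ) : dualConfig ⁻¹' LR n = (LR n)ᶜ := by
  ext ω
  rcases exactly_one n ω with ⟨h1, h2⟩ | ⟨h1, h2⟩
  · exact ⟨fun h => absurd h h2, fun h => absurd h1 h⟩
  · exact ⟨fun _ => h2, fun _ => h1⟩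

/-- **P6 Theorem 4.4**: `P_½(LR_n) = ½` for every `n`. -/
theorem P_half_LR_eq_half (n : ℕ) : P 2 (clamp (1 / 2)) (LR n) = 1 / 2 := by
  have h1 : P 2 (clamp (1 / 2)) (LR n) + P 2 (clamp (1 / 2)) (LR n) = 1 := by
    have h := P_half_preimage_dualConfig (measurableSet_LR n)
    rw [preimage_dualConfig_LR] at h
    have h' := prob_add_prob_compl (μ := P 2 (clamp (1 / 2))) (measurableSet_LR n)
    rw [h] at h'
    exact h'
  have h2 : (2 : ℝ≥0∞) * P 2 (clamp (1 / 2)) (LR n) = 1 := by rw [two_mul, h1]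
  exact (ENNReal.eq_div_iff (by norm_num) (by simp)).2 h2

/-- `P_½(LR_n) = ½`, real form. -/
theorem P_half_LR_eq_half_real (n : ℕ) : (P 2 (clamp (1 / 2)) (LR n)).toReal = 1 / 2 := by
  rw [P_half_LR_eq_half]
  simp

end Summit.Ventures.PercRepro0.Separation
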